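import Summits.Ventures.PercRepro.C025ProfileHallOne

/-!
# C-033 «SHADOW HALL» — night-2's shadow forms at `q = 1` from the row `q = 1` of `(H⁺)` (night-3 g7)

The row `q = 1` of the Hall form `(H⁺)` (`hallIneq_one_all`, C025ProfileHallOne) specialises to night-2's two shadow
statements at `q = 1`, for every finite matroid and every `p`:

* `shadowHallLevel_one`: `ShadowHallLevel M p 1 u (C(p+1,u)/C(p+1,p))` for `1 < u < p` — the level-wise shadow form
  `ShadowC025Level` at `q = 1` (every bottom set has price `C(p+1,u)/C(p+1,1) = C(p+1,u)/C(p+1,p)`);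
* `card_shadow_eq_sum_shadowLevel`: the shadow in the middle level `Yq M p q` is the disjoint union of the shadows at
  the levels `q < u < p` (fibres of the rank);
* `shadowHall_one`: `ShadowHall M p 1 (phiK p 1)` — the shadow form `ShadowC025` at `q = 1` for every `p` (sum the levels,
  `phiK_eq_sum_levels`); hence `hall_one`: the per-flat Hall condition `Hall M p 1 (phiK p 1)` (C-029 at `q = 1`) and
  the body of `C025` at `(p, 1)` once more (`c025_of_shadowHall`).
-/

open scoped Matroid

namespace PercRepro

open Set Finset ThmH

section HallOneShadow

variable {α : Type} [DecidableEq α] {M : Matroid α} [M.Finite]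

/-- **The level-wise shadow form at `q = 1`** (night-2's `ShadowC025Level` instantiated at `q = 1`): for `1 < u < p`
and every family `𝒜` of bottom sets of `(p, 1)`, `C(p+1,u)/C(p+1,p) · #𝒜 ≤ #∂_u 𝒜`. -/
theorem shadowHallLevel_one (M : Matroid α) [M.Finite] {p u : ℕ} (hqu : 1 < u) (hup : u < p) :
    Shadow.ShadowHallLevel M p 1 u (((p + 1).choose u : ℚ) / ((p + 1).choose p : ℚ)) := by
  intro 𝒜 h𝒜
  have hsub : 𝒜 ⊆ Profile.Rq M 1 := h𝒜.trans (Profile.Uq_subset_Rq p 1)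
  have h1 := profileHall_row_one M u hqu 𝒜 hsub
  have h2 : ∑ B ∈ 𝒜, Profile.price M 1 u B =
      (𝒜.card : ℚ) * (((p + 1).choose u : ℚ) / ((p + 1).choose p : ℚ)) := by
    rw [Finset.sum_congr rfl (fun B hB => Profile.price_of_mem_Uq hup.le (h𝒜 hB)), Finset.sum_const,
      nsmul_eq_mul, Nat.choose_symm_add]
  rw [mul_comm, ← h2]
  exact h1

/-- The shadow of `𝒜` in the middle level `Yq M p q` is the disjoint union of its shadows at the levels `q < u < p`. -/
theorem card_shadow_eq_sum_shadowLevel (p q : ℕ) (𝒜 : Finset (Finset α)) :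
    (Shadow.shadow M p q 𝒜).card = ∑ u ∈ Finset.Ioo q p, (Shadow.shadowLevel M u 𝒜).card := by
  classical
  have hmem : ∀ S ∈ Shadow.shadow M p q 𝒜, (M.eRk (S : Set α)).toNat ∈ Finset.Ioo q p := by
    intro S hS
    have hY := Shadow.shadow_subset_Yq 𝒜 hS
    simp only [Finset.mem_filter, PerFlat.Yq, Finset.mem_powerset] at hY
    obtain ⟨_, hq, hp⟩ := hY
    have hne : M.eRk (S : Set α) ≠ ⊤ := ne_top_of_lt hp
    rw [Finset.mem_Ioo]
    constructor
    · have := hq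
      rw [← ENat.coe_toNat hne] at this
      exact_mod_cast this
    · have := hp
      rw [← ENat.coe_toNat hne] at this
      exact_mod_cast this
  rw [Finset.card_eq_sum_card_fiberwise hmem]
  apply Finset.sum_congr rfl
  intro u hu
  rw [Finset.mem_Ioo] at hu
  congr 1
  ext S
  simp only [Finset.mem_filter, Shadow.mem_shadow, PerFlat.Yq, Finset.mem_powerset, mem_shadowLevel,
    Profile.mem_levelSet]
  constructor
  · rintro ⟨⟨⟨hS, _, hp⟩, hB⟩, hrk⟩
    refine ⟨⟨hS, ?_⟩, hB⟩
    have hne : M.eRk (S : Set α) ≠ ⊤ := ne_top_of_lt hp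
    rw [← ENat.coe_toNat hne, hrk]
  · rintro ⟨⟨hS, hrk⟩, hB⟩
    refine ⟨⟨⟨hS, ?_, ?_⟩, hB⟩, ?_⟩
    · rw [hrk]; exact_mod_cast hu.1
    · rw [hrk]; exact_mod_cast hu.2
    · rw [hrk, ENat.toNat_coe]

/-- **The shadow form at `q = 1`** (night-2's `ShadowC025` instantiated at `q = 1`): for every `p` and every family
`𝒜` of bottom sets of `(p, 1)`, `Φ(p,1) · #𝒜 ≤ #shadow(𝒜)`. -/
theorem shadowHall_one (M : Matroid α) [M.Finite] (p : ℕ) : Shadow.ShadowHall M p 1 (phiK p 1) := by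
  intro 𝒜 h𝒜
  have hsum : ((Shadow.shadow M p 1 𝒜).card : ℚ) = ∑ u ∈ Finset.Ioo 1 p, ((Shadow.shadowLevel M u 𝒜).card : ℚ) := by
    exact_mod_cast card_shadow_eq_sum_shadowLevel (M := M) p 1 𝒜
  rw [hsum, Profile.phiK_eq_sum_levels, Finset.sum_mul]
  apply Finset.sum_le_sum
  intro u hu
  rw [Finset.mem_Ioo] at hu
  have h := shadowHallLevel_one M hu.1 hu.2 𝒜 h𝒜
  rw [Nat.choose_symm_add] at h
  exact h

/-- **The per-flat Hall condition at `q = 1`** (C-029 at `q = 1`): `Hall M p 1 (phiK p 1)` for every `p`. -/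
theorem hall_one (M : Matroid α) [M.Finite] (p : ℕ) : PerFlat.Hall M p 1 (phiK p 1) :=
  Shadow.hall_of_shadowHall (shadowHall_one M p)

end HallOneShadow

end PercRepro
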